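import Mathlib.Analysis.SpecialFunctions.Pow.Deriv
import Mathlib.Analysis.SpecialFunctions.Pow.Continuity
import Mathlib.Analysis.Analytic.IsolatedZeros
import Mathlib.Analysis.Complex.CauchyIntegral
import Mathlib.Analysis.Complex.Convex
import Mathlib.MeasureTheory.Integral.DominatedConvergence
import Mathlib.MeasureTheory.Function.SpecialFunctions.Basic
import Literature.Analysis.Complex.HolomorphicParametricIntegral
import Literature.NumberTheory.Automorphic.PairLFunctionPolesProofs
import HarnessLib

/-!
# Arthur–Clozel (2.3) from real-point Rankin–Selberg data: the moment form of the last step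

Topic `NumberTheory/Automorphic`; namespace `Literature.NumberTheory.Automorphic`. Proof file
(theorems only: no definition, no named fact, no instance) under the named fact
`JacquetShalika1981_partialPairL_pole_of_eq_conj` of `PairLFunctionPoles` — Arthur–Clozel,
*Simple algebras, base change, and the advanced theory of the trace formula*, Ann. of Math.
Stud. 120 (1989), Ch. 3 §2, (2.3), p. 171 of the held copy ("the limit
`lim_{s → 1, Re s > 1} (s - 1) L^S(s, π ⊗ σ)` exists and is finite and non-zero" for `π ≅ σ̃`;
"cf. [Jacquet–Shalika II, Prop. 3.6]").

## The decomposition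

In print (Jacquet–Shalika, *Euler products I*, §4 and *II*, §3; Cogdell (2004), §2.3, Thm. 2.2,
§4.2) the pole of `L^S(s, σ̃ × σ)` at `s = 1` is read off the identity
`I(s; φ̄, φ, Φ) = A(s) · L^S(s)` between the global Rankin–Selberg integral `I` (simple pole at
`s = 1` with residue `c Φ̂(0) ‖φ‖² ≠ 0`), the partial `L`-function, and the product `A(s)` of the
local integrals at the finitely many remaining places, *together with* the local theorems that
`A` is holomorphic up to `Re s = 1` and can be made non-zero at `s = 1`. The reduction
`JacquetShalika1981_partialPairL_pole_of_eq_conj_of_rankinSelberg` (`PairLFunctionPolesRankinSelberg`)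
consumes exactly this: a complex identity on `Re s > 1` and a limit `A(s) → a ≠ 0`.

The tree's Rankin–Selberg machinery, however, produces its identities **at real points** and in
`[0, ∞]` (`WhittakerTowerParseval`: `C · Ψ(σ; W_φ, W̄_φ, Φ) = ∫ ‖φ‖² E_w`, `σ > 1` real;
`RankinSelbergTorusIntegral`: Euler factors of the torus integral at real `σ`), where the factor
in front of the Euler product is a **moment** `A(σ) = ∫ G · w^σ dm` of one fixed non-negative
function `G = |W_φ|² Φ δ_B⁻¹` against the weight `w = |det a|` over the bad part of the torus.
This file proves that in this situation nothing else local is needed beyond the **finiteness of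
the first moment** `∫ G · w dm < ∞` (the absolute convergence of the ramified and archimedean
local integrals *at* `s = 1`, Jacquet–Shalika I, §1 and §3; Cogdell (2004), Thm. 3.2 (1), p. 192:
"for `π` and `π'` unitary … they converge absolutely for `Re(s) ≥ 1`"):

* `norm_ofReal_mul_ofReal_cpow`, `rpow_le_rpow_add_rpow_of_le_of_le` — `‖G · w^s‖ = G · w^{re s}`
  and the two-sided domination `w^b ≤ w^a + w^c` (`a ≤ b ≤ c`, `w > 0`);
* `differentiableOn_integral_mul_cpow` — **moments are holomorphic**: if `∫ G w^σ < ∞` for all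
  real `σ > 1` then `s ↦ ∫ G · w^s dm` is holomorphic on `Re s > 1`
  (`Literature.Analysis.Complex.differentiableOn_integral_of_dominated`);
* `integral_mul_cpow_ofReal` — at real points the complex moment is the real one;
* `tendsto_integral_mul_cpow_nhdsWithin_one` — **continuity at the edge**: if moreover
  `∫ G w < ∞` (and `∫ G w² < ∞`), then `∫ G · w^s dm → ∫ G · w dm` as `s → 1`, `Re s > 1`
  (dominated convergence with the majorant `G (w + w²)` on `1 ≤ Re s ≤ 2`);
* `exists_ne_zero_tendsto_sub_one_mul_of_integral_mul_cpow` — **the last step, complex form**: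
  if `(s - 1) I(s) → r ≠ 0` and `I(s) = κ · (∫ G w^s) · L(s)` near `1` on `Re s > 1` (`κ ≠ 0`),
  with `∫ G w < ∞`, `∫ G w² < ∞`, then `(s - 1) L(s)` has a finite **non-zero** limit at `1` from
  `Re s > 1`. The non-vanishing `∫ G w ≠ 0` of the limit of the moments is *automatic*: were it
  zero, `G = 0` a.e., all moments vanish, `I = 0` near `1` and `r = 0`. So no local non-vanishing
  theorem (Jacquet–Shalika I, §1 (end), §3; Cogdell §4.2 "for any `s₀` … there is a choice of local
  `W_v`, `W'_v`, `Φ_v` such that `e_v(s₀; …) ≠ 0`") is needed for (2.3);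
* `exists_ne_zero_tendsto_sub_one_mul_of_real_moments` — **the last step, real form**: the same
  conclusion from the identity `I(σ) = κ · (∫ G w^σ) · L(σ)` at **real** `σ > 1` only, provided
  `I` and `L` are holomorphic on `Re s > 1` and all moments `∫ G w^σ`, `σ > 1`, are finite
  (identity theorem on the half-plane, `AnalyticOnNhd.eqOn_of_preconnected_of_frequently_eq`);
* `exists_ne_zero_tendsto_sub_one_mul_of_real_moments_strip`, `…_of_real_lmoments_strip` — the
  same with `I`, `L` holomorphic only on the strip `1 < Re s < 2` (where the tree bounds the
  Eisenstein series uniformly) and the identity only for `1 < σ < 2`;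
* `JacquetShalika1981_partialPairL_pole_of_eq_conj_of_real_moments` — consequently Arthur–Clozel's
  (2.3) follows from such real-point data `(I, κ, G, w)` for `L = L^S(s, α ⊗ β)` in every instance.

Everything here is measure theory and one complex variable; no automorphic input is used beyond
the statement of the fact and the non-triviality of the boundary filter
(`nhdsWithin_one_lt_re_neBot`).

## References

* J. Arthur, L. Clozel, *Simple algebras, base change, and the advanced theory of the trace
  formula*, Ann. of Math. Stud. 120 (1989), Ch. 3 §2, (2.3), p. 171. [ArthurClozelAMS120]
* H. Jacquet, J. A. Shalika, *On Euler products and the classification of automorphic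
  representations I*, Amer. J. Math. 103 (1981), 499–558, §§1, 3, 4 [JacquetShalikaAJM1981];
  *II*, Amer. J. Math. 103 (1981), 777–815, §3, Prop. 3.6 [JacquetShalikaAJM1981II].
* J. W. Cogdell, *Analytic theory of `L`-functions for `GL_n`*, in J. Bernstein, S. Gelbart (eds.),
  *An Introduction to the Langlands Program* (2004), §2.3, Thm. 3.2 (PDF p. 192), §4.2
  (PDF pp. 202–203 of the held copy `book:editornd-introduction-langlands-program`).
  [CogdellAnalyticTheory2004]
-/

noncomputable section

open scoped Topology ENNReal
open MeasureTheory Filter Set Metric Complex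

namespace Literature.NumberTheory.Automorphic

/-! ### Moments `∫ G · w^s` of a non-negative function: holomorphy and continuity at the edge -/

section Moments

variable {X : Type*} [MeasurableSpace X] {m : Measure X} {G w : X → ℝ}

/-- `‖G(x) w(x)^s‖ = G(x) w(x)^{re s}` for `G(x) ≥ 0`, `w(x) > 0`. [folklore] -/
theorem norm_ofReal_mul_ofReal_cpow {g t : ℝ} (hg : 0 ≤ g) (ht : 0 < t) (s : ℂ) :
    ‖(g : ℂ) * (t : ℂ) ^ s‖ = g * t ^ s.re := by
  rw [norm_mul, Complex.norm_real, Real.norm_of_nonneg hg, Complex.norm_cpow_eq_rpow_re_of_pos ht]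

/-- Two-sided domination of real powers: for `t > 0` and `a ≤ b ≤ c`, `t^b ≤ t^a + t^c`
(`t^b ≤ t^a` if `t ≤ 1`, `t^b ≤ t^c` if `t ≥ 1`). [folklore] -/
theorem rpow_le_rpow_add_rpow_of_le_of_le {t a b c : ℝ} (ht : 0 < t) (hab : a ≤ b) (hbc : b ≤ c) :
    t ^ b ≤ t ^ a + t ^ c := by
  rcases le_or_gt t 1 with h1 | h1
  · exact (Real.rpow_le_rpow_of_exponent_ge ht h1 hab).trans
      (le_add_of_nonneg_right (Real.rpow_nonneg ht.le c))
  · exact (Real.rpow_le_rpow_of_exponent_le h1.le hbc).trans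
      (le_add_of_nonneg_left (Real.rpow_nonneg ht.le a))

/-- The integrand `x ↦ G(x) w(x)^s` of the complex moment is measurable. [folklore] -/
theorem measurable_ofReal_mul_ofReal_cpow (hG : Measurable G) (hw : Measurable w) (s : ℂ) :
    Measurable fun x => (G x : ℂ) * (w x : ℂ) ^ s :=
  hG.complex_ofReal.mul (hw.complex_ofReal.pow_const s)

/-- **At real points the complex moment is the real moment**:
`∫ G · w^{σ} dm = ∫ G w^σ dm` for real `σ` (`w ≥ 0`). [folklore] -/
theorem integral_mul_cpow_ofReal (hw0 : ∀ x, 0 < w x) (σ : ℝ) :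
    (∫ x, (G x : ℂ) * (w x : ℂ) ^ (σ : ℂ) ∂m) = ((∫ x, G x * w x ^ σ ∂m : ℝ) : ℂ) := by
  rw [← integral_complex_ofReal]
  refine integral_congr_ae (Eventually.of_forall fun x => ?_)
  simp only [Complex.ofReal_mul, Complex.ofReal_cpow (hw0 x).le]

/-- **Moments are holomorphic.** If `G ≥ 0`, `w > 0` are measurable and `∫ G w^σ dm < ∞` for
every real `σ > 1`, then `s ↦ ∫ G(x) w(x)^s dm(x)` is holomorphic on `Re s > 1`: near `s₀` the
integrand is dominated by `G (w^{σ₀ - R} + w^{σ₀ + R})`, `R = (re s₀ - 1)/2`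
(`Literature.Analysis.Complex.differentiableOn_integral_of_dominated`). [folklore] -/
theorem differentiableOn_integral_mul_cpow (hG : Measurable G) (hw : Measurable w)
    (hG0 : ∀ x, 0 ≤ G x) (hw0 : ∀ x, 0 < w x)
    (hint : ∀ σ : ℝ, 1 < σ → Integrable (fun x => G x * w x ^ σ) m) :
    DifferentiableOn ℂ (fun s => ∫ x, (G x : ℂ) * (w x : ℂ) ^ s ∂m) {s : ℂ | 1 < s.re} := by
  refine Literature.Analysis.Complex.differentiableOn_integral_of_dominated
    (fun s _ => (measurable_ofReal_mul_ofReal_cpow hG hw s).aestronglyMeasurable)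
    (Eventually.of_forall fun x s _ => ?_) ?_
  · -- holomorphy of the integrand in `s`
    exact ((differentiableAt_id.const_cpow
      (Or.inl (Complex.ofReal_ne_zero.mpr (hw0 x).ne'))).const_mul _).differentiableWithinAt
  · -- local domination
    intro s₀ hs₀
    have hs₀' : 1 < s₀.re := hs₀
    set R : ℝ := (s₀.re - 1) / 2 with hR
    have hRpos : 0 < R := by rw [hR]; linarith
    have hre : ∀ s ∈ ball s₀ R, s₀.re - R ≤ s.re ∧ s.re ≤ s₀.re + R := by
      intro s hs
      rw [Metric.mem_ball, dist_eq_norm] at hs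
      have h1 : |s.re - s₀.re| ≤ ‖s - s₀‖ := by
        simpa [Complex.sub_re] using Complex.abs_re_le_norm (s - s₀)
      have h2 := abs_le.mp (h1.trans hs.le)
      constructor <;> linarith [h2.1, h2.2]
    refine ⟨R, hRpos, fun s hs => ?_, fun x => G x * w x ^ (s₀.re - R) + G x * w x ^ (s₀.re + R),
      (hint _ (by rw [hR]; linarith)).add (hint _ (by rw [hR]; linarith)), ?_⟩
    · show 1 < s.re
      have := (hre s hs).1
      rw [hR] at this
      linarith
    · refine Eventually.of_forall fun x s hs => ?_
      show ‖(G x : ℂ) * (w x : ℂ) ^ s‖ ≤ G x * w x ^ (s₀.re - R) + G x * w x ^ (s₀.re + R)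
      rw [norm_ofReal_mul_ofReal_cpow (hG0 x) (hw0 x), ← mul_add]
      exact mul_le_mul_of_nonneg_left
        (rpow_le_rpow_add_rpow_of_le_of_le (hw0 x) (hre s hs).1 (hre s hs).2) (hG0 x)

/-- **Continuity of the moments at the edge `s = 1`.** If `G ≥ 0`, `w > 0` are measurable and the
first and second moments `∫ G w dm`, `∫ G w² dm` are finite, then
`∫ G · w^s dm → ∫ G w dm` as `s → 1`, `Re s > 1` (dominated convergence: for `1 ≤ Re s ≤ 2` the
integrand is dominated by `G (w + w²)`). [folklore] -/
theorem tendsto_integral_mul_cpow_nhdsWithin_one (hG : Measurable G) (hw : Measurable w)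
    (hG0 : ∀ x, 0 ≤ G x) (hw0 : ∀ x, 0 < w x)
    (h1 : Integrable (fun x => G x * w x) m) (h2 : Integrable (fun x => G x * w x ^ (2 : ℝ)) m) :
    Tendsto (fun s => ∫ x, (G x : ℂ) * (w x : ℂ) ^ s ∂m) (𝓝[{s : ℂ | 1 < s.re}] 1)
      (𝓝 ((∫ x, G x * w x ∂m : ℝ) : ℂ)) := by
  -- eventually `1 < re s ≤ 2` along the boundary filter
  have hev : ∀ᶠ s in 𝓝[{s : ℂ | 1 < s.re}] (1 : ℂ), 1 < s.re ∧ s.re ≤ 2 := by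
    have h₁ : ∀ᶠ s in 𝓝[{s : ℂ | 1 < s.re}] (1 : ℂ), 1 < s.re := eventually_mem_nhdsWithin
    have h₂ : ∀ᶠ s in 𝓝[{s : ℂ | 1 < s.re}] (1 : ℂ), s.re < 2 := by
      refine mem_nhdsWithin_of_mem_nhds ?_
      exact (Complex.continuous_re.isOpen_preimage _ isOpen_Iio).mem_nhds (by simp)
    filter_upwards [h₁, h₂] with s hs hs'
    exact ⟨hs, hs'.le⟩
  have hlim := tendsto_integral_filter_of_dominated_convergence
    (l := 𝓝[{s : ℂ | 1 < s.re}] (1 : ℂ)) (μ := m)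
    (F := fun s x => (G x : ℂ) * (w x : ℂ) ^ s) (f := fun x => ((G x * w x : ℝ) : ℂ))
    (fun x => G x * w x + G x * w x ^ (2 : ℝ))
    (Eventually.of_forall fun s => (measurable_ofReal_mul_ofReal_cpow hG hw s).aestronglyMeasurable)
    ?_ (h1.add h2) ?_
  · rwa [integral_complex_ofReal] at hlim
  · filter_upwards [hev] with s hs
    refine Eventually.of_forall fun x => ?_
    rw [norm_ofReal_mul_ofReal_cpow (hG0 x) (hw0 x)]
    have h := rpow_le_rpow_add_rpow_of_le_of_le (hw0 x) hs.1.le hs.2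
    rw [Real.rpow_one] at h
    calc G x * w x ^ s.re ≤ G x * (w x + w x ^ (2 : ℝ)) := mul_le_mul_of_nonneg_left h (hG0 x)
      _ = G x * w x + G x * w x ^ (2 : ℝ) := mul_add _ _ _
  · refine Eventually.of_forall fun x => ?_
    have hc : Tendsto (fun s : ℂ => (G x : ℂ) * (w x : ℂ) ^ s) (𝓝 1)
        (𝓝 ((G x : ℂ) * (w x : ℂ) ^ (1 : ℂ))) :=
      ((continuousAt_const_cpow (Complex.ofReal_ne_zero.mpr (hw0 x).ne')).tendsto).const_mul _
    rw [Complex.cpow_one, ← Complex.ofReal_mul] at hc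
    exact hc.mono_left nhdsWithin_le_nhds

end Moments

/-! ### The last step of the printed proof, in moment form -/

section LastStep

variable {X : Type*} [MeasurableSpace X] {m : Measure X} {G w : X → ℝ}

/-- **(2.3), last step, complex form.** Let `l` be the boundary filter "`s → 1`, `Re s > 1`".
Suppose `(s - 1) I(s) → r ≠ 0` along `l` (the residue of the global Rankin–Selberg integral,
`RankinSelbergResidueDatum`), and `I(s) = κ · (∫ G(x) w(x)^s dm) · L(s)` eventually along `l`
with `κ ≠ 0`, `G ≥ 0`, `w > 0` measurable and `∫ G w dm < ∞`, `∫ G w² dm < ∞`. Then `(s - 1) L(s)`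
has a finite **non-zero** limit along `l`, namely `r / (κ ∫ G w dm)`. The point: `∫ G w dm ≠ 0`
needs no proof of its own — if it vanished, `G = 0` a.e., every moment vanishes, `I = 0` near `1`
and `r = 0`. (Jacquet–Shalika II, §3 / Cogdell (2004), §4.2, with the local non-vanishing argument
removed.) [folklore] -/
theorem exists_ne_zero_tendsto_sub_one_mul_of_integral_mul_cpow {L I : ℂ → ℂ} {r κ : ℂ}
    (hr : r ≠ 0) (hκ : κ ≠ 0)
    (hI : Tendsto (fun s => (s - 1) * I s) (𝓝[{s : ℂ | 1 < s.re}] 1) (𝓝 r))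
    (hG : Measurable G) (hw : Measurable w) (hG0 : ∀ x, 0 ≤ G x) (hw0 : ∀ x, 0 < w x)
    (h1 : Integrable (fun x => G x * w x) m) (h2 : Integrable (fun x => G x * w x ^ (2 : ℝ)) m)
    (hid : ∀ᶠ s in 𝓝[{s : ℂ | 1 < s.re}] 1,
      I s = κ * (∫ x, (G x : ℂ) * (w x : ℂ) ^ s ∂m) * L s) :
    ∃ c : ℂ, c ≠ 0 ∧ Tendsto (fun s => (s - 1) * L s) (𝓝[{s : ℂ | 1 < s.re}] 1) (𝓝 c) := by
  set A : ℂ → ℂ := fun s => ∫ x, (G x : ℂ) * (w x : ℂ) ^ s ∂m with hA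
  set a : ℝ := ∫ x, G x * w x ∂m with ha
  have hAt : Tendsto A (𝓝[{s : ℂ | 1 < s.re}] 1) (𝓝 (a : ℂ)) :=
    tendsto_integral_mul_cpow_nhdsWithin_one hG hw hG0 hw0 h1 h2
  -- the first moment does not vanish: otherwise `G = 0` a.e., `A = 0`, `I = 0` near `1`, `r = 0`
  have ha0 : a ≠ 0 := by
    intro ha0
    have hae : (fun x => G x * w x) =ᵐ[m] 0 :=
      (integral_eq_zero_iff_of_nonneg (fun x => mul_nonneg (hG0 x) (hw0 x).le) h1).mp ha0
    have hG0ae : ∀ᵐ x ∂m, G x = 0 := by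
      filter_upwards [hae] with x hx
      exact (mul_eq_zero.mp hx).resolve_right (hw0 x).ne'
    have hA0 : ∀ s, A s = 0 := fun s => by
      refine integral_eq_zero_of_ae ?_
      filter_upwards [hG0ae] with x hx
      simp [hx]
    have hI0 : (fun s => (s - 1) * I s) =ᶠ[𝓝[{s : ℂ | 1 < s.re}] 1] fun _ => (0 : ℂ) := by
      filter_upwards [hid] with s hs
      rw [hs, show (∫ x, (G x : ℂ) * (w x : ℂ) ^ s ∂m) = A s from rfl, hA0 s]
      ring
    exact hr (tendsto_nhds_unique (hI.congr' hI0) tendsto_const_nhds)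
  have hκa : κ * (a : ℂ) ≠ 0 := mul_ne_zero hκ (Complex.ofReal_ne_zero.mpr ha0)
  have hκA : Tendsto (fun s => κ * A s) (𝓝[{s : ℂ | 1 < s.re}] 1) (𝓝 (κ * a)) :=
    hAt.const_mul κ
  have hne : ∀ᶠ s in 𝓝[{s : ℂ | 1 < s.re}] 1, κ * A s ≠ 0 := hκA.eventually_ne hκa
  refine ⟨r / (κ * a), div_ne_zero hr hκa, ?_⟩
  refine ((hI.div hκA hκa).congr' ?_)
  filter_upwards [hne, hid] with s hs hsI
  have hAs : A s ≠ 0 := (mul_ne_zero_iff.mp hs).2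
  rw [Pi.div_apply, hsI, show (∫ x, (G x : ℂ) * (w x : ℂ) ^ s ∂m) = A s from rfl]
  field_simp

/-- **(2.3), last step, real-moment form** — the decomposition by which the tree's real-point
Rankin–Selberg identities discharge the fact. Let `I`, `L` be holomorphic on `Re s > 1` with
`(s - 1) I(s) → r ≠ 0` as `s → 1`, `Re s > 1`. Suppose that at every **real** `σ > 1`,
`I(σ) = κ · (∫ G w^σ dm) · L(σ)` for one fixed measurable `G ≥ 0`, `w > 0` (the bad-place part
of the unfolded integral and the Euler product: Jacquet–Shalika I, §4; Cogdell (2004), Thm. 2.1,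
Thm. 2.2, evaluated at real points), `κ ≠ 0`, with all moments `∫ G w^σ dm`, `σ > 1`, finite (the
unfolded integral is finite for `σ > 1`, `RankinSelbergTowerFiniteness`), and that the **first
moment is finite**, `∫ G w dm < ∞` (absolute convergence of the remaining local integrals at
`s = 1`: Jacquet–Shalika I, §1, §3; Cogdell (2004), Thm. 3.2 (1)). Then `(s - 1) L(s)` has a
finite non-zero limit as `s → 1`, `Re s > 1`. Proof: the moment function `s ↦ ∫ G · w^s dm` is
holomorphic on `Re s > 1` (`differentiableOn_integral_mul_cpow`) and agrees with the real moments
on `(1, ∞)`, which accumulates at `2`; by the identity theorem `I = κ · (∫ G w^s) · L` on the whole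
half-plane, and `exists_ne_zero_tendsto_sub_one_mul_of_integral_mul_cpow` applies.
[cite: CogdellAnalyticTheory2004, §4.2] -/
theorem exists_ne_zero_tendsto_sub_one_mul_of_real_moments {L I : ℂ → ℂ} {r κ : ℂ}
    (hr : r ≠ 0) (hκ : κ ≠ 0)
    (hIhol : DifferentiableOn ℂ I {s : ℂ | 1 < s.re})
    (hLhol : DifferentiableOn ℂ L {s : ℂ | 1 < s.re})
    (hI : Tendsto (fun s => (s - 1) * I s) (𝓝[{s : ℂ | 1 < s.re}] 1) (𝓝 r))
    (hG : Measurable G) (hw : Measurable w) (hG0 : ∀ x, 0 ≤ G x) (hw0 : ∀ x, 0 < w x)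
    (hint : ∀ σ : ℝ, 1 < σ → Integrable (fun x => G x * w x ^ σ) m)
    (h1 : Integrable (fun x => G x * w x) m)
    (hidσ : ∀ σ : ℝ, 1 < σ → I σ = κ * (∫ x, G x * w x ^ σ ∂m : ℝ) * L σ) :
    ∃ c : ℂ, c ≠ 0 ∧ Tendsto (fun s => (s - 1) * L s) (𝓝[{s : ℂ | 1 < s.re}] 1) (𝓝 c) := by
  set U : Set ℂ := {s : ℂ | 1 < s.re} with hU
  have hUo : IsOpen U := isOpen_lt continuous_const Complex.continuous_re
  set A : ℂ → ℂ := fun s => ∫ x, (G x : ℂ) * (w x : ℂ) ^ s ∂m with hA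
  have hAhol : DifferentiableOn ℂ A U := differentiableOn_integral_mul_cpow hG hw hG0 hw0 hint
  -- identity theorem: `I = κ A L` on `U`
  set g : ℂ → ℂ := fun s => κ * A s * L s with hg
  have hghol : DifferentiableOn ℂ g U := (hAhol.const_mul κ).mul hLhol
  have hfreq : ∃ᶠ z in 𝓝[≠] (2 : ℂ), I z = g z := by
    -- along the real points `σ ↓ 2`
    have hT : Tendsto (fun σ : ℝ => (σ : ℂ)) (𝓝[Ioi (2 : ℝ)] 2) (𝓝[≠] (2 : ℂ)) := by
      refine tendsto_nhdsWithin_iff.mpr ⟨?_, ?_⟩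
      · have h := (Complex.continuous_ofReal.tendsto (2 : ℝ)).mono_left
          (nhdsWithin_le_nhds (s := Ioi (2 : ℝ)))
        simpa using h
      · filter_upwards [self_mem_nhdsWithin] with σ hσ
        have hσ2 : σ ≠ 2 := ne_of_gt hσ
        simp only [mem_compl_iff, mem_singleton_iff]
        exact_mod_cast hσ2
    have hev : ∀ᶠ σ : ℝ in 𝓝[Ioi (2 : ℝ)] 2, I (σ : ℂ) = g (σ : ℂ) := by
      filter_upwards [self_mem_nhdsWithin] with σ hσ
      have hσ1 : 1 < σ := lt_trans one_lt_two hσ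
      simp only [hg, hA, integral_mul_cpow_ofReal hw0 σ]
      exact hidσ σ hσ1
    exact hT.frequently hev.frequently
  have heq : EqOn I g U :=
    (hIhol.analyticOnNhd hUo).eqOn_of_preconnected_of_frequently_eq (hghol.analyticOnNhd hUo)
      (convex_halfSpace_re_gt 1).isPreconnected (by simp [hU] : (2 : ℂ) ∈ U) hfreq
  refine exists_ne_zero_tendsto_sub_one_mul_of_integral_mul_cpow hr hκ hI hG hw hG0 hw0 h1
    (by simpa using hint 2 one_lt_two) ?_
  filter_upwards [self_mem_nhdsWithin] with s hs
  exact heq hs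

/-- **(2.3), last step, real-moment form with `[0, ∞]`-valued data** — the currency of the
tree's Rankin–Selberg files (`rankinSelbergTorusIntegral`, `towerIntegral` are `∫⁻`-integrals of
`ℝ≥0∞`-valued integrands). As `exists_ne_zero_tendsto_sub_one_mul_of_real_moments`, with the
moments given as `∫⁻ g · w^σ dm` for a measurable `g : X → [0, ∞]`: all of them finite for `σ > 1`,
the **first moment `∫⁻ g · w dm` finite**, and `I(σ) = κ · (∫⁻ g w^σ).toReal · L(σ)` at real `σ > 1`.
(Passage to `G = g.toReal`: `integral_toReal`, `integrable_toReal_of_lintegral_ne_top`.)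
[cite: CogdellAnalyticTheory2004, §4.2] -/
theorem exists_ne_zero_tendsto_sub_one_mul_of_real_lmoments {L I : ℂ → ℂ} {r κ : ℂ}
    (hr : r ≠ 0) (hκ : κ ≠ 0)
    (hIhol : DifferentiableOn ℂ I {s : ℂ | 1 < s.re})
    (hLhol : DifferentiableOn ℂ L {s : ℂ | 1 < s.re})
    (hI : Tendsto (fun s => (s - 1) * I s) (𝓝[{s : ℂ | 1 < s.re}] 1) (𝓝 r))
    {g : X → ℝ≥0∞} (hg : Measurable g) (hw : Measurable w) (hw0 : ∀ x, 0 < w x)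
    (hfin : ∀ σ : ℝ, 1 < σ → ∫⁻ x, g x * ENNReal.ofReal (w x ^ σ) ∂m ≠ ∞)
    (h1 : ∫⁻ x, g x * ENNReal.ofReal (w x) ∂m ≠ ∞)
    (hidσ : ∀ σ : ℝ, 1 < σ →
      I σ = κ * ((∫⁻ x, g x * ENNReal.ofReal (w x ^ σ) ∂m).toReal : ℝ) * L σ) :
    ∃ c : ℂ, c ≠ 0 ∧ Tendsto (fun s => (s - 1) * L s) (𝓝[{s : ℂ | 1 < s.re}] 1) (𝓝 c) := by
  set G : X → ℝ := fun x => (g x).toReal with hG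
  have hGm : Measurable G := hg.ennreal_toReal
  have hG0 : ∀ x, 0 ≤ G x := fun x => ENNReal.toReal_nonneg
  -- the `ℝ≥0∞`-moments are the real moments of `G`
  have hmeasσ : ∀ σ : ℝ, Measurable fun x => g x * ENNReal.ofReal (w x ^ σ) := fun σ =>
    hg.mul (hw.pow_const σ).ennreal_ofReal
  have htoRealσ : ∀ (σ : ℝ) (x : X), (g x * ENNReal.ofReal (w x ^ σ)).toReal = G x * w x ^ σ :=
    fun σ x => by rw [ENNReal.toReal_mul, ENNReal.toReal_ofReal (Real.rpow_nonneg (hw0 x).le σ)]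
  have hintσ : ∀ σ : ℝ, 1 < σ → Integrable (fun x => G x * w x ^ σ) m := fun σ hσ => by
    have h := integrable_toReal_of_lintegral_ne_top (hmeasσ σ).aemeasurable (hfin σ hσ)
    exact h.congr (Eventually.of_forall fun x => htoRealσ σ x)
  have hmomσ : ∀ σ : ℝ, 1 < σ →
      (∫⁻ x, g x * ENNReal.ofReal (w x ^ σ) ∂m).toReal = ∫ x, G x * w x ^ σ ∂m := fun σ hσ => by
    rw [← integral_toReal (hmeasσ σ).aemeasurable (ae_lt_top (hmeasσ σ) (hfin σ hσ))]
    exact integral_congr_ae (Eventually.of_forall fun x => htoRealσ σ x)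
  -- the first moment
  have hmeas1 : Measurable fun x => g x * ENNReal.ofReal (w x) := hg.mul hw.ennreal_ofReal
  have h1' : Integrable (fun x => G x * w x) m := by
    have h := integrable_toReal_of_lintegral_ne_top hmeas1.aemeasurable h1
    refine h.congr (Eventually.of_forall fun x => ?_)
    show (g x * ENNReal.ofReal (w x)).toReal = G x * w x
    rw [ENNReal.toReal_mul, ENNReal.toReal_ofReal (hw0 x).le]
  refine exists_ne_zero_tendsto_sub_one_mul_of_real_moments hr hκ hIhol hLhol hI hGm hw hG0 hw0
    hintσ h1' fun σ hσ => ?_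
  rw [hidσ σ hσ, hmomσ σ hσ]

/-- **(2.3), last step, real-moment form on the strip `1 < Re s < 2`.** As
`exists_ne_zero_tendsto_sub_one_mul_of_real_moments`, but with `I` (and `L`) only required to be
holomorphic on the open strip `{1 < Re s < 2}` — the region where the tree bounds the mirabolic
Eisenstein series uniformly (`enorm_mirabolicEisenstein_le_of_le_norm_sub_one` of
`RankinSelbergIntegralLine`: `1 < re s ≤ 2`), so that the holomorphy of the global Rankin–Selberg
integral is only needed there. The identity theorem is run on the (convex) strip with the real
points `σ ↓ 3/2`. [folklore] -/
theorem exists_ne_zero_tendsto_sub_one_mul_of_real_moments_strip {L I : ℂ → ℂ} {r κ : ℂ}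
    (hr : r ≠ 0) (hκ : κ ≠ 0)
    (hIhol : DifferentiableOn ℂ I {s : ℂ | 1 < s.re ∧ s.re < 2})
    (hLhol : DifferentiableOn ℂ L {s : ℂ | 1 < s.re ∧ s.re < 2})
    (hI : Tendsto (fun s => (s - 1) * I s) (𝓝[{s : ℂ | 1 < s.re}] 1) (𝓝 r))
    (hG : Measurable G) (hw : Measurable w) (hG0 : ∀ x, 0 ≤ G x) (hw0 : ∀ x, 0 < w x)
    (hint : ∀ σ : ℝ, 1 < σ → Integrable (fun x => G x * w x ^ σ) m)
    (h1 : Integrable (fun x => G x * w x) m)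
    (hidσ : ∀ σ : ℝ, 1 < σ → σ < 2 → I σ = κ * (∫ x, G x * w x ^ σ ∂m : ℝ) * L σ) :
    ∃ c : ℂ, c ≠ 0 ∧ Tendsto (fun s => (s - 1) * L s) (𝓝[{s : ℂ | 1 < s.re}] 1) (𝓝 c) := by
  set U : Set ℂ := {s : ℂ | 1 < s.re ∧ s.re < 2} with hU
  have hUo : IsOpen U :=
    (isOpen_lt continuous_const Complex.continuous_re).inter
      (isOpen_lt Complex.continuous_re continuous_const)
  have hUc : IsPreconnected U := by
    have hconv : Convex ℝ U := (convex_halfSpace_re_gt 1).inter (convex_halfSpace_re_lt 2)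
    exact hconv.isPreconnected
  set A : ℂ → ℂ := fun s => ∫ x, (G x : ℂ) * (w x : ℂ) ^ s ∂m with hA
  have hAhol : DifferentiableOn ℂ A U :=
    (differentiableOn_integral_mul_cpow hG hw hG0 hw0 hint).mono fun s hs => hs.1
  -- identity theorem: `I = κ A L` on `U`
  set g : ℂ → ℂ := fun s => κ * A s * L s with hg
  have hghol : DifferentiableOn ℂ g U := (hAhol.const_mul κ).mul hLhol
  set z₀ : ℂ := ((3 / 2 : ℝ) : ℂ) with hz₀
  have hz₀U : z₀ ∈ U := by
    refine ⟨?_, ?_⟩ <;> simp only [hz₀, Complex.ofReal_re] <;> norm_num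
  have hfreq : ∃ᶠ z in 𝓝[≠] z₀, I z = g z := by
    -- along the real points `σ ↓ 3/2`
    have hT : Tendsto (fun σ : ℝ => (σ : ℂ)) (𝓝[Ioi (3 / 2 : ℝ)] (3 / 2)) (𝓝[≠] z₀) := by
      refine tendsto_nhdsWithin_iff.mpr ⟨?_, ?_⟩
      · exact (Complex.continuous_ofReal.tendsto (3 / 2 : ℝ)).mono_left
          (nhdsWithin_le_nhds (s := Ioi (3 / 2 : ℝ)))
      · filter_upwards [self_mem_nhdsWithin] with σ hσ
        have hσ2 : σ ≠ 3 / 2 := ne_of_gt hσ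
        simp only [mem_compl_iff, mem_singleton_iff, hz₀]
        exact fun h => hσ2 (Complex.ofReal_injective h)
    have hev : ∀ᶠ σ : ℝ in 𝓝[Ioi (3 / 2 : ℝ)] (3 / 2), I (σ : ℂ) = g (σ : ℂ) := by
      have hIio : ∀ᶠ σ : ℝ in 𝓝[Ioi (3 / 2 : ℝ)] (3 / 2), σ < 2 :=
        mem_nhdsWithin_of_mem_nhds (Iio_mem_nhds (by norm_num))
      filter_upwards [self_mem_nhdsWithin, hIio] with σ hσ hσ2
      have hσ1 : 1 < σ := lt_trans (by norm_num) hσ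
      simp only [hg, hA, integral_mul_cpow_ofReal hw0 σ]
      exact hidσ σ hσ1 hσ2
    exact hT.frequently hev.frequently
  have heq : EqOn I g U :=
    (hIhol.analyticOnNhd hUo).eqOn_of_preconnected_of_frequently_eq (hghol.analyticOnNhd hUo)
      hUc hz₀U hfreq
  -- `U` is a neighbourhood of `1` within `Re s > 1`
  have hUmem : U ∈ 𝓝[{s : ℂ | 1 < s.re}] (1 : ℂ) := by
    have h₂ : {s : ℂ | s.re < 2} ∈ 𝓝 (1 : ℂ) :=
      (Complex.continuous_re.isOpen_preimage _ isOpen_Iio).mem_nhds (by simp)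
    filter_upwards [self_mem_nhdsWithin, mem_nhdsWithin_of_mem_nhds h₂] with s hs hs'
    exact ⟨hs, hs'⟩
  refine exists_ne_zero_tendsto_sub_one_mul_of_integral_mul_cpow hr hκ hI hG hw hG0 hw0 h1
    (by simpa using hint 2 one_lt_two) ?_
  filter_upwards [hUmem] with s hs
  exact heq hs

/-- The strip form with `[0, ∞]`-valued moments (as `exists_ne_zero_tendsto_sub_one_mul_of_real_lmoments`).
[folklore] -/
theorem exists_ne_zero_tendsto_sub_one_mul_of_real_lmoments_strip {L I : ℂ → ℂ} {r κ : ℂ}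
    (hr : r ≠ 0) (hκ : κ ≠ 0)
    (hIhol : DifferentiableOn ℂ I {s : ℂ | 1 < s.re ∧ s.re < 2})
    (hLhol : DifferentiableOn ℂ L {s : ℂ | 1 < s.re ∧ s.re < 2})
    (hI : Tendsto (fun s => (s - 1) * I s) (𝓝[{s : ℂ | 1 < s.re}] 1) (𝓝 r))
    {g : X → ℝ≥0∞} (hg : Measurable g) (hw : Measurable w) (hw0 : ∀ x, 0 < w x)
    (hfin : ∀ σ : ℝ, 1 < σ → ∫⁻ x, g x * ENNReal.ofReal (w x ^ σ) ∂m ≠ ∞)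
    (h1 : ∫⁻ x, g x * ENNReal.ofReal (w x) ∂m ≠ ∞)
    (hidσ : ∀ σ : ℝ, 1 < σ → σ < 2 →
      I σ = κ * ((∫⁻ x, g x * ENNReal.ofReal (w x ^ σ) ∂m).toReal : ℝ) * L σ) :
    ∃ c : ℂ, c ≠ 0 ∧ Tendsto (fun s => (s - 1) * L s) (𝓝[{s : ℂ | 1 < s.re}] 1) (𝓝 c) := by
  set G : X → ℝ := fun x => (g x).toReal with hG
  have hGm : Measurable G := hg.ennreal_toReal
  have hG0 : ∀ x, 0 ≤ G x := fun x => ENNReal.toReal_nonneg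
  have hmeasσ : ∀ σ : ℝ, Measurable fun x => g x * ENNReal.ofReal (w x ^ σ) := fun σ =>
    hg.mul (hw.pow_const σ).ennreal_ofReal
  have htoRealσ : ∀ (σ : ℝ) (x : X), (g x * ENNReal.ofReal (w x ^ σ)).toReal = G x * w x ^ σ :=
    fun σ x => by rw [ENNReal.toReal_mul, ENNReal.toReal_ofReal (Real.rpow_nonneg (hw0 x).le σ)]
  have hintσ : ∀ σ : ℝ, 1 < σ → Integrable (fun x => G x * w x ^ σ) m := fun σ hσ => by
    have h := integrable_toReal_of_lintegral_ne_top (hmeasσ σ).aemeasurable (hfin σ hσ)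
    exact h.congr (Eventually.of_forall fun x => htoRealσ σ x)
  have hmomσ : ∀ σ : ℝ, 1 < σ →
      (∫⁻ x, g x * ENNReal.ofReal (w x ^ σ) ∂m).toReal = ∫ x, G x * w x ^ σ ∂m := fun σ hσ => by
    rw [← integral_toReal (hmeasσ σ).aemeasurable (ae_lt_top (hmeasσ σ) (hfin σ hσ))]
    exact integral_congr_ae (Eventually.of_forall fun x => htoRealσ σ x)
  have hmeas1 : Measurable fun x => g x * ENNReal.ofReal (w x) := hg.mul hw.ennreal_ofReal
  have h1' : Integrable (fun x => G x * w x) m := by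
    have h := integrable_toReal_of_lintegral_ne_top hmeas1.aemeasurable h1
    refine h.congr (Eventually.of_forall fun x => ?_)
    show (g x * ENNReal.ofReal (w x)).toReal = G x * w x
    rw [ENNReal.toReal_mul, ENNReal.toReal_ofReal (hw0 x).le]
  refine exists_ne_zero_tendsto_sub_one_mul_of_real_moments_strip hr hκ hIhol hLhol hI hGm hw hG0
    hw0 hintσ h1' fun σ hσ hσ2 => ?_
  rw [hidσ σ hσ hσ2, hmomσ σ hσ]

end LastStep

/-! ### Arthur–Clozel (2.3) from real-point data -/

section Fact

open NumberField IsDedekindDomain AdelicGroupData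

variable {n : ℕ} {K : Type} [Field K] [NumberField K]
  {μ : Measure (gl n K).automorphicQuotient} [(gl n K).IsAutomorphicMeasure μ]

/-- **Arthur–Clozel's (2.3) from real-point Rankin–Selberg data.** The named fact
`JacquetShalika1981_partialPairL_pole_of_eq_conj` follows if for every instance — unitary
cuspidal `π = σ̄` on `GL_n(𝔸_K)` (`n ≥ 1`), a finite `S`, Satake families `α`, `β` of `π`, `σ`
off `S` — there are a function `I` holomorphic on `Re s > 1` with `(s - 1) I(s) → r ≠ 0` at `1`
(in the tree: the global Rankin–Selberg integral of a smoothed vector of `σ` and its conjugate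
against the mirabolic Eisenstein series, `RankinSelbergResidueDatum`), a measure space with
measurable `G ≥ 0`, `w > 0` whose moments `∫ G w^σ`, `σ > 1`, are finite and whose **first
moment `∫ G w` is finite**, and `κ ≠ 0`, such that `L^S(s, α ⊗ β) = partialPairL S α β` is
holomorphic on `Re s > 1` and `I(σ) = κ · (∫ G w^σ) · L^S(σ, α ⊗ β)` at every real `σ > 1`
(unfolding, Euler factorisation off `S` and the unramified computation, all at real points).
[cite: ArthurClozelAMS120, Ch. 3 §2 (2.3)] -/
theorem JacquetShalika1981_partialPairL_pole_of_eq_conj_of_real_moments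
    (h : ∀ (_hn : 0 < n) (P P' : CuspidalAutomorphicRepGL n K μ) (_he : P = P'.conj)
      {S : Set (HeightOneSpectrum (𝓞 K))} (_hS : S.Finite)
      {α β : SatakeFamily K} (_hα : IsSatakeFamilyOf P S α) (_hβ : IsSatakeFamilyOf P' S β),
      ∃ (X : Type) (_ : MeasurableSpace X) (m : Measure X) (G w : X → ℝ) (I : ℂ → ℂ) (r κ : ℂ),
        r ≠ 0 ∧ κ ≠ 0 ∧ DifferentiableOn ℂ I {s : ℂ | 1 < s.re} ∧
        DifferentiableOn ℂ (partialPairL S α β) {s : ℂ | 1 < s.re} ∧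
        Tendsto (fun s => (s - 1) * I s) (𝓝[{s : ℂ | 1 < s.re}] 1) (𝓝 r) ∧
        Measurable G ∧ Measurable w ∧ (∀ x, 0 ≤ G x) ∧ (∀ x, 0 < w x) ∧
        (∀ σ : ℝ, 1 < σ → Integrable (fun x => G x * w x ^ σ) m) ∧
        Integrable (fun x => G x * w x) m ∧
        ∀ σ : ℝ, 1 < σ → I σ = κ * (∫ x, G x * w x ^ σ ∂m : ℝ) * partialPairL S α β σ) :
    JacquetShalika1981_partialPairL_pole_of_eq_conj (n := n) (K := K) (μ := μ) := by
  intro hn P P' he S hS α β hα hβ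
  obtain ⟨X, _, m, G, w, I, r, κ, hr, hκ, hIhol, hLhol, hI, hG, hw, hG0, hw0, hint, h1, hid⟩ :=
    h hn P P' he hS hα hβ
  exact exists_ne_zero_tendsto_sub_one_mul_of_real_moments hr hκ hIhol hLhol hI hG hw hG0 hw0
    hint h1 hid

end Fact

end Literature.NumberTheory.Automorphic
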